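import Literature.Probability.LatticeModels.RegularScales
import Literature.Probability.LatticeModels.DirInvCorrLength
import Literature.Probability.LatticeModels.ImprovedTreeDiagramBoundSum
import HarnessLib

/-!
# A pointwise lower bound on the two-point function in the window (Aizenman–Duminil-Copin 2021, Cor. 5.8, four-dimensional Ising model)

Topic `Literature/Probability/LatticeModels`; family `crit-ising` (crit-ising.S13). Theorems only: no
definition and no named fact is introduced.

M. Aizenman, H. Duminil-Copin, Ann. of Math. **194** (2021) = arXiv:1912.07973, **Corollary 5.8**
(Lower bound on `S_{ρ,β}`, p. 19): "there exists `c = c(d) > 0` such that for every `β ≤ β_c(ρ)` and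
`x ∈ ℤ^d`, `S_{ρ,β}(x) ≥ (c/(β|J|)) ‖x‖_∞^{-(d-1)} exp(-(d‖x‖_∞+1)/ξ(ρ,β))`" — used in §6 inside the window
`‖x‖ ≲ ξ(β)`, where the exponential is a constant ("the lower bound (5.26) to bound the denominator",
proof of Lemma 6.7, p. 25; proof of Thm 5.12, "`χ_N ≥ c₀N`"). This file proves the window form for the
nearest-neighbour Ising model on `ℤ⁴`:

* `twoPointFree_ge_of_window` — for `0 < β ≤ β_c`, `2 ≤ N` with `N ≤ ξ(β)` (`β = β_c`, or
  `N ξ(β)⁻¹ ≤ 1`), and every `x ≠ 0` with `16‖x‖_∞ ≤ N`: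
  `⟨σ₀σ_x⟩^∅_β ≥ θ / (216 (16‖x‖_∞)³)`, `θ = e^{-2}/(32 β_c)`.

Proof: the sphere sum at radius `16‖x‖_∞` is at least `θ` in the window (the tree's
`sphereSum_ge_of_window`, i.e. the Simon–Lieb mechanism of Cor. 5.8 through `ψ_β(Λ_n) ≥ e^{-(n+2)/L}`),
every point `y` of that sphere has `S(y) ≤ S(16‖x‖_∞ e₁) ≤ S(x)` by the Messager–Miracle-Solé
inequalities (`twoPointFree_le_single_of_le`, `twoPointFree_single_le_of_mul_le` of `RegularScales`:
the printed "by (5.21), `S(u) ≤ S(x)` for all `u ∈ ∂Λ_L`", `L = d‖x‖_∞`), and `|∂Λ_m| ≤ 216 m³`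
(`card_sphere_four_le`).

## References

* M. Aizenman, H. Duminil-Copin, Ann. of Math. 194 (2021), arXiv:1912.07973, Cor. 5.8 and its proof
  (p. 19); proof of Lemma 6.7 (p. 25) [AizenmanDuminilCopinAnnals2021].
-/

noncomputable section

open MeasureTheory Filter Topology Finset

namespace Literature.Probability.LatticeModels

/-- **Pointwise lower bound on the two-point function in the window** (Aizenman–Duminil-Copin 2021,
Cor. 5.8, four-dimensional nearest-neighbour Ising model, scales below `ξ(β)`): for `0 < β ≤ β_c`,
`2 ≤ N ≤ ξ(β)` and `x ≠ 0` with `16‖x‖_∞ ≤ N`,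
`⟨σ₀σ_x⟩^∅_β ≥ e^{-2}/(32 β_c) / (216 (16 ‖x‖_∞)³)`. [cite: AizenmanDuminilCopinAnnals2021, arXiv:1912.07973 Corollary 5.8 (p. 19)] -/
theorem twoPointFree_ge_of_window {β : ℝ} (hβ : 0 < β) (hβc : β ≤ criticalBeta 4) {N : ℕ} (hN : 2 ≤ N)
    (hwin : β = criticalBeta 4 ∨ (0 < β ∧ (N : ℝ) * invCorrLength (twoPointPlus 4 β) ≤ 1))
    {x : Site 4} (hx : x ≠ 0) (hxN : 16 * Site.supNorm x ≤ N) :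
    Real.exp (-2) / (32 * criticalBeta 4) / (216 * (16 * (Site.supNorm x : ℝ)) ^ 3) ≤ twoPointFree 4 β x := by
  set m : ℕ := Site.supNorm x with hm
  have hm1 : 1 ≤ m := Nat.one_le_iff_ne_zero.2 fun h => hx (Site.supNorm_eq_zero_iff.1 h)
  have h4 : (1 : ℕ) ≤ 4 := by norm_num
  have hpos : 0 < twoPointPlus 4 β (Pi.single 0 1) := twoPointPlus_single_pos hβ 0
  -- the sphere sum at radius `16 m` is at least `θ`
  have hsphere := sphereSum_ge_of_window hβ hβc hN hwin hpos (n := 16 * m) hxN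
  -- `⟨·⟩⁺ = ⟨·⟩^∅` on two-point functions (`m*(β) = 0` for `β ≤ β_c`, Lebowitz–Martin-Löf)
  have hmag : spontaneousMagnetization 4 β = 0 := by
    rcases hβc.lt_or_eq with hlt | heq
    · exact le_antisymm
        (not_lt.1 fun hpos' => not_le.2 hlt (csInf_le ⟨0, fun _ hb => hb.1⟩ ⟨hβ.le, hpos'⟩))
        (spontaneousMagnetization_nonneg_holds (d := 4) hβ.le)
    · rw [heq]
      exact spontaneousMagnetization_criticalBeta_eq_zero_holds (d := 4) (by norm_num)
  have hconv : ∑ y ∈ sphere 4 (16 * m), twoPointPlus 4 β y = ∑ y ∈ sphere 4 (16 * m), twoPointFree 4 β y :=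
    Finset.sum_congr rfl fun y _ =>
      (twoPointFree_eq_twoPointPlus_of_spontaneousMagnetization_eq_zero hβ.le hmag y).symm
  rw [hconv] at hsphere
  -- every point of that sphere is dominated by `S(x)`
  have hdom : ∀ y ∈ sphere 4 (16 * m), twoPointFree 4 β y ≤ twoPointFree 4 β x := fun y hy =>
    (twoPointFree_le_single_of_le hβ.le h4 (s := 16 * m) (by rw [mem_sphere.1 hy])).trans
      (twoPointFree_single_le_of_mul_le hβ.le h4 (by omega))
  have hsum : ∑ y ∈ sphere 4 (16 * m), twoPointFree 4 β y ≤ #(sphere 4 (16 * m)) * twoPointFree 4 β x := by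
    rw [← nsmul_eq_mul, ← Finset.sum_const]
    exact Finset.sum_le_sum hdom
  have hcard : (#(sphere 4 (16 * m)) : ℝ) ≤ 216 * (16 * (m : ℝ)) ^ 3 := by
    have h := card_sphere_four_le (m := 16 * m) (by omega)
    push_cast at h
    exact h
  have hSx : 0 ≤ twoPointFree 4 β x := twoPointFree_nonneg_of_nonneg hβ.le x
  have hden : (0 : ℝ) < 216 * (16 * (m : ℝ)) ^ 3 := by
    have : (1 : ℝ) ≤ m := by exact_mod_cast hm1
    positivity
  rw [div_le_iff₀ hden]
  calc Real.exp (-2) / (32 * criticalBeta 4) ≤ ∑ y ∈ sphere 4 (16 * m), twoPointFree 4 β y := hsphere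
    _ ≤ #(sphere 4 (16 * m)) * twoPointFree 4 β x := hsum
    _ ≤ 216 * (16 * (m : ℝ)) ^ 3 * twoPointFree 4 β x := mul_le_mul_of_nonneg_right hcard hSx
    _ = twoPointFree 4 β x * (216 * (16 * (m : ℝ)) ^ 3) := mul_comm _ _

/-- The same bound with the constant collected: there is `c > 0` (namely `e^{-2}/(32 β_c · 216 · 16³)`)
with `⟨σ₀σ_x⟩^∅_β ≥ c ‖x‖_∞^{-3}` for all `0 < β ≤ β_c`, `2 ≤ N ≤ ξ(β)`, `x ≠ 0`, `16‖x‖_∞ ≤ N` — the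
printed `c ‖x‖_∞^{-(d-1)}` with `d = 4`, the factor `exp(-(d‖x‖+1)/ξ)` being bounded below in the
window. [cite: AizenmanDuminilCopinAnnals2021, arXiv:1912.07973 Corollary 5.8 (p. 19)] -/
theorem exists_twoPointFree_ge_inv_cube_of_window :
    ∃ c : ℝ, 0 < c ∧ ∀ β : ℝ, 0 < β → β ≤ criticalBeta 4 → ∀ N : ℕ, 2 ≤ N →
      (β = criticalBeta 4 ∨ (0 < β ∧ (N : ℝ) * invCorrLength (twoPointPlus 4 β) ≤ 1)) →
      ∀ x : Site 4, x ≠ 0 → 16 * Site.supNorm x ≤ N →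
        c / (Site.supNorm x : ℝ) ^ 3 ≤ twoPointFree 4 β x := by
  have hβc0 : 0 < criticalBeta 4 := criticalBeta_pos_holds (d := 4) (by norm_num)
  refine ⟨Real.exp (-2) / (32 * criticalBeta 4) / (216 * 16 ^ 3), by positivity,
    fun β hβ hβc N hN hwin x hx hxN => ?_⟩
  have h := twoPointFree_ge_of_window hβ hβc hN hwin hx hxN
  have hm : (0 : ℝ) < Site.supNorm x := by
    have : 1 ≤ Site.supNorm x := Nat.one_le_iff_ne_zero.2 fun h => hx (Site.supNorm_eq_zero_iff.1 h)
    exact_mod_cast this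
  refine le_trans (le_of_eq ?_) h
  field_simp

end Literature.Probability.LatticeModels
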